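import Summits.MatrixMultiplication.MatrixMultiplication.Theorems.FarEdgeDescentSpectralAudit
import Literature.Computability.AlgebraicComplexity.RectangularExponentSymmetry
import Literature.Computability.AlgebraicComplexity.RectangularExponentSubadditivity
import HarnessLib

/-!
# FarEdgeDescent — PENCIL REALISABILITY: the fold is the complete 2D law of a 3D-lawful functional

Route `FarEdgeDescent` (lens «structural dichotomy», cell `decomp-mm`, gen 24), companion of
`FarEdgeDescentSpectralWorlds/…/SpectralAudit`.  Question: which 1D profiles `F : [0,∞) → ℝ` are the pencil
`x ↦ W(1,x,1)` of SOME 3D-lawful functional `W` (symmetric, positively homogeneous, subadditive on the open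
positive cone — the laws `ω(·,·,·)` has: `omegaRect_swap₁₂/₂₃`, `LottiRomani1983_homogeneous/_subadditive`)?

* NECESSITY (§1, abstract): ANY such `W` obeys on its pencil the FOLD `(1+y)·W(1,2/(1+y),1) ≤ 2·W(1,y,1)` and
  the CUBE LINE `(K+2)·W(1,1,1) ≤ 3·W(1,K,1)` — the gen-8 / gen-13 arguments run on the laws alone.  Hence the
  audit of `FarEdgeDescentSpectralAudit` is rigorous: gen 21's `tangentialWorld` profile is the pencil of NO
  lawful functional (`tangentialWorld_not_a_pencil`).
* SUFFICIENCY (§2, the PERSPECTIVE WORLD): conversely, if `f` is convex and monotone on `[0,∞)`, `1`-Lipschitz,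
  `max(2,x+1) ≤ f ≤ x+2`, and satisfies the FOLD for all `y ≥ 0`, then the symmetrised perspective
  `W_f(a,b,c) := max over the three slots of ((sum of the other two)/2)·f(2·slot/(sum of the other two))`
  IS a lawful functional (symmetric, homogeneous, subadditive, monotone, sandwiched
  `max(a+b,b+c,c+a) ≤ W_f ≤ a+b+c` on the open positive cone) whose pencil is EXACTLY `f` — and the pencil
  identity `W_f(1,x,1) = f(x)` is EQUIVALENT to the fold (`perspectiveWorld_pencil_iff_fold`).
* LEAST EXTENSION (§3): any lawful `V` with pencil `f` satisfies `W_f ≤ V` on the open positive cone — `W_f` is the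
  MINIMUM of the fibre; and (§4) the true pencil `x ↦ ω(1,x,1)` is admissible (`omega_pencil_admissible`), so its
  perspective world `W_ω` is a lawful MINORANT of `ω` with the true pencil (`omega_perspective_minorant`).
So: «lawful pencil» ⟺ «convex, monotone, 1-Lipschitz, floors/ceiling, FOLD»; the cube line and every other
pencil consequence of 3D-lawfulness is generated by the fold (its iterates converge to the cube line).  For the
lineage this settles the world-building licence: a 1D model world needs exactly ONE 2D check, the fold on the
whole half-line — and the gen-17/21 worlds that skipped it are precisely the ones the audit caught.
(§0 records that `ω` itself has the three laws in the shape used here.)  No new definitions.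
-/

set_option linter.dupNamespace false

noncomputable section

namespace Summit.MatrixMultiplication.MatrixMultiplication.Theorems.FarEdgeDescentPencilRealisability

open Literature.Computability.AlgebraicComplexity Set
open Summit.MatrixMultiplication.MatrixMultiplication.Theorems.FarEdgeDescentSpectralAudit
  (tangentialWorld_violates_cubeLine)

/-! ## §0 The true functional has the three laws (packaged in the shape of §1) -/

/-- `ω(a,b,c)` over `ℂ` is symmetric (two generating transpositions), positively homogeneous and subadditive
on the open positive cone. [cite: LottiRomani1983, §1] -/
theorem omegaRect_laws :
    (∀ a b c : ℝ, omegaRect ℂ a b c = omegaRect ℂ b a c ∧ omegaRect ℂ a b c = omegaRect ℂ a c b) ∧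
    (∀ ν : ℝ, 0 < ν → ∀ a b c : ℝ, 0 < a → 0 < b → 0 < c →
      omegaRect ℂ (ν * a) (ν * b) (ν * c) = ν * omegaRect ℂ a b c) ∧
    (∀ a b c a' b' c' : ℝ, 0 < a → 0 < b → 0 < c → 0 < a' → 0 < b' → 0 < c' →
      omegaRect ℂ (a + a') (b + b') (c + c') ≤ omegaRect ℂ a b c + omegaRect ℂ a' b' c') :=
  ⟨fun a b c => ⟨omegaRect_swap₁₂ ℂ a b c, omegaRect_swap₂₃ ℂ a b c⟩,
    fun _ hν _ _ _ ha hb hc => LottiRomani1983_homogeneous ℂ hν.le ha.le hb.le hc.le,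
    fun a b c a' b' c' _ _ _ _ _ _ => LottiRomani1983_subadditive ℂ a b c a' b' c'⟩

/-! ## §1 NECESSITY: fold and cube line from the laws alone -/

section Necessity

variable {W : ℝ → ℝ → ℝ → ℝ}
  (hsymm : ∀ a b c : ℝ, W a b c = W b a c ∧ W a b c = W a c b)
  (hhom : ∀ ν : ℝ, 0 < ν → ∀ a b c : ℝ, 0 < a → 0 < b → 0 < c →
    W (ν * a) (ν * b) (ν * c) = ν * W a b c)
  (hsub : ∀ a b c a' b' c' : ℝ, 0 < a → 0 < b → 0 < c → 0 < a' → 0 < b' → 0 < c' →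
    W (a + a') (b + b') (c + c') ≤ W a b c + W a' b' c')
include hsymm hhom hsub

/-- ★ FOLD FROM THE LAWS: `(1+y)·W(1, 2/(1+y), 1) ≤ 2·W(1,y,1)` for `y > 0`
(`W(1,y,1) + W(y,1,1) ≥ W(1+y,1+y,2) = (1+y)·W(1,1,2/(1+y))`). -/
theorem fold_of_laws {y : ℝ} (hy : 0 < y) : (1 + y) * W 1 (2 / (1 + y)) 1 ≤ 2 * W 1 y 1 := by
  have hy1 : 0 < 1 + y := by linarith
  have h2 := hsub 1 y 1 y 1 1 one_pos hy one_pos hy one_pos one_pos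
  have h3 := hhom (1 + y) hy1 1 1 (2 / (1 + y)) one_pos one_pos (by positivity)
  rw [mul_one, show (1 + y) * (2 / (1 + y)) = 1 + 1 by field_simp; ring] at h3
  -- h3 : W (1 + y) (1 + y) (1 + 1) = (1 + y) * W 1 1 (2 / (1 + y))
  have h4 : W 1 1 (2 / (1 + y)) = W 1 (2 / (1 + y)) 1 := (hsymm 1 1 (2 / (1 + y))).2
  rw [show y + 1 = 1 + y by ring, h3, h4, (hsymm y 1 1).1] at h2
  linarith

/-- ★ CUBE LINE FROM THE LAWS: `(K+2)·W(1,1,1) ≤ 3·W(1,K,1)` for `K > 0`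
(`W(1,K,1) + W(K,1,1) + W(1,1,K) ≥ W(K+2,K+2,K+2)`). -/
theorem cubeLine_of_laws {K : ℝ} (hK : 0 < K) : (K + 2) * W 1 1 1 ≤ 3 * W 1 K 1 := by
  have hK2 : 0 < K + 2 := by linarith
  have h1 := hsub 1 K 1 K 1 1 one_pos hK one_pos hK one_pos one_pos
  have h2 := hsub (1 + K) (K + 1) (1 + 1) 1 1 K (by linarith) (by linarith) (by norm_num) one_pos one_pos hK
  have h3 := hhom (K + 2) hK2 1 1 1 one_pos one_pos one_pos
  rw [mul_one] at h3
  rw [show (1 : ℝ) + K + 1 = K + 2 by ring, show K + 1 + 1 = K + 2 by ring,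
    show (1 : ℝ) + 1 + K = K + 2 by ring, h3] at h2
  have s2 : W 1 1 K = W 1 K 1 := ((hsymm 1 K 1).2).symm
  rw [(hsymm K 1 1).1] at h1
  linarith

/-- COROLLARY (audit made rigorous): gen 21's `tangentialWorld` profile `x+1+(2−x)₊²/4` is the pencil of NO
symmetric, homogeneous, subadditive functional. -/
theorem tangentialWorld_not_a_pencil :
    ¬ ∀ x : ℝ, 0 < x → W 1 x 1 = (fun x : ℝ => x + 1 + max (2 - x) 0 ^ 2 / 4) x := by
  intro h
  apply tangentialWorld_violates_cubeLine
  intro K hK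
  have hc := cubeLine_of_laws hsymm hhom hsub (show 0 < K by linarith)
  rw [h 1 one_pos, h K (by linarith)] at hc
  exact hc

end Necessity

/-! ## §2 SUFFICIENCY: the perspective world of an admissible profile -/

section Sufficiency

variable {f : ℝ → ℝ} {W : ℝ → ℝ → ℝ → ℝ}
  (hW : ∀ a b c : ℝ, W a b c = max ((a + c) / 2 * f (2 * b / (a + c)))
    (max ((a + b) / 2 * f (2 * c / (a + b))) ((b + c) / 2 * f (2 * a / (b + c)))))

/-- PERSPECTIVE SUBADDITIVITY (Jensen): `((S+S')/2)·f(2(b+b')/(S+S')) ≤ (S/2)·f(2b/S) + (S'/2)·f(2b'/S')`. -/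
theorem persp_subadd (hconv : ConvexOn ℝ (Ici 0) f) {S S' b b' : ℝ} (hS : 0 < S) (hS' : 0 < S')
    (hb : 0 ≤ b) (hb' : 0 ≤ b') :
    (S + S') / 2 * f (2 * (b + b') / (S + S')) ≤ S / 2 * f (2 * b / S) + S' / 2 * f (2 * b' / S') := by
  have hSS : 0 < S + S' := by linarith
  have hx1 : (2 * b / S) ∈ Ici (0 : ℝ) := mem_Ici.2 (by positivity)
  have hx2 : (2 * b' / S') ∈ Ici (0 : ℝ) := mem_Ici.2 (by positivity)
  have hj := hconv.2 hx1 hx2 (show (0 : ℝ) ≤ S / (S + S') by positivity)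
    (show (0 : ℝ) ≤ S' / (S + S') by positivity) (show S / (S + S') + S' / (S + S') = 1 by field_simp)
  simp only [smul_eq_mul] at hj
  have e : S / (S + S') * (2 * b / S) + S' / (S + S') * (2 * b' / S') = 2 * (b + b') / (S + S') := by
    field_simp
  rw [e] at hj
  have hj' := mul_le_mul_of_nonneg_left hj (le_of_lt (half_pos hSS))
  have e2 : (S + S') / 2 * (S / (S + S') * f (2 * b / S) + S' / (S + S') * f (2 * b' / S')) =
      S / 2 * f (2 * b / S) + S' / 2 * f (2 * b' / S') := by
    field_simp
  linarith [e2]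

/-- PERSPECTIVE MONOTONICITY in the weight: `S ≤ S' ⟹ (S/2)·f(2b/S) ≤ (S'/2)·f(2b/S')`
(uses `1`-Lipschitz and `f(x) ≥ x+1`: tangent intercepts are nonnegative). -/
theorem persp_mono_weight (hlip : ∀ x y : ℝ, 0 ≤ x → x ≤ y → f y - f x ≤ y - x)
    (hlow : ∀ x : ℝ, 0 ≤ x → max 2 (x + 1) ≤ f x) {S S' b : ℝ} (hS : 0 < S) (hSS : S ≤ S') (hb : 0 ≤ b) :
    S / 2 * f (2 * b / S) ≤ S' / 2 * f (2 * b / S') := by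
  have hS' : 0 < S' := lt_of_lt_of_le hS hSS
  have hx' : 0 ≤ 2 * b / S' := by positivity
  have hxx : 2 * b / S' ≤ 2 * b / S := by
    apply div_le_div_of_nonneg_left (by positivity) hS hSS
  have hl := hlip (2 * b / S') (2 * b / S) hx' hxx
  have hfl : 2 * b / S' + 1 ≤ f (2 * b / S') := (le_max_right _ _).trans (hlow _ hx')
  -- S/2 f(x) ≤ S/2 (f x' + x - x') and the rest is the sign of (S'-S)(f x' - x')
  have h1 : S / 2 * f (2 * b / S) ≤ S / 2 * (f (2 * b / S') + (2 * b / S - 2 * b / S')) :=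
    mul_le_mul_of_nonneg_left (by linarith) (by positivity)
  have e : S / 2 * (f (2 * b / S') + (2 * b / S - 2 * b / S')) =
      S' / 2 * f (2 * b / S') - (S' - S) / 2 * (f (2 * b / S') - 2 * b / S') := by
    field_simp
    ring
  have h2 : 0 ≤ (S' - S) / 2 * (f (2 * b / S') - 2 * b / S') :=
    mul_nonneg (by linarith) (by linarith)
  linarith [e]

include hW

/-- LAW: `S₃`-symmetry of the perspective world (two generating transpositions). -/
theorem perspectiveWorld_symm (a b c : ℝ) : W a b c = W b a c ∧ W a b c = W a c b := by
  refine ⟨?_, ?_⟩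
  · rw [hW, hW, add_comm b a]
    ac_rfl
  · rw [hW, hW, add_comm c b]
    ac_rfl

/-- LAW: positive homogeneity of the perspective world. -/
theorem perspectiveWorld_hom {ν : ℝ} (hν : 0 < ν) (a b c : ℝ) :
    W (ν * a) (ν * b) (ν * c) = ν * W a b c := by
  rw [hW, hW]
  have e1 : 2 * (ν * b) / (ν * a + ν * c) = 2 * b / (a + c) := by
    rw [← mul_add, mul_left_comm, mul_div_mul_left _ _ hν.ne']
  have e2 : 2 * (ν * c) / (ν * a + ν * b) = 2 * c / (a + b) := by
    rw [← mul_add, mul_left_comm, mul_div_mul_left _ _ hν.ne']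
  have e3 : 2 * (ν * a) / (ν * b + ν * c) = 2 * a / (b + c) := by
    rw [← mul_add, mul_left_comm, mul_div_mul_left _ _ hν.ne']
  rw [e1, e2, e3, mul_max_of_nonneg _ _ hν.le, mul_max_of_nonneg _ _ hν.le]
  congr 1
  · ring
  · congr 1 <;> ring

/-- LAW: subadditivity of the perspective world on the open positive cone (needs only convexity of `f`). -/
theorem perspectiveWorld_subadd (hconv : ConvexOn ℝ (Ici 0) f) {a b c a' b' c' : ℝ} (ha : 0 < a)
    (hb : 0 < b) (hc : 0 < c) (ha' : 0 < a') (hb' : 0 < b') (hc' : 0 < c') :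
    W (a + a') (b + b') (c + c') ≤ W a b c + W a' b' c' := by
  rw [hW, hW, hW]
  have t1 := persp_subadd hconv (S := a + c) (S' := a' + c') (b := b) (b' := b') (by linarith) (by linarith)
    hb.le hb'.le
  have t2 := persp_subadd hconv (S := a + b) (S' := a' + b') (b := c) (b' := c') (by linarith) (by linarith)
    hc.le hc'.le
  have t3 := persp_subadd hconv (S := b + c) (S' := b' + c') (b := a) (b' := a') (by linarith) (by linarith)
    ha.le ha'.le
  rw [show a + a' + (c + c') = a + c + (a' + c') by ring, show a + a' + (b + b') = a + b + (a' + b') by ring,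
    show b + b' + (c + c') = b + c + (b' + c') by ring]
  refine max_le ?_ (max_le ?_ ?_)
  · exact t1.trans (add_le_add (le_max_left _ _) (le_max_left _ _))
  · exact t2.trans (add_le_add ((le_max_left _ _).trans (le_max_right _ _))
      ((le_max_left _ _).trans (le_max_right _ _)))
  · exact t3.trans (add_le_add ((le_max_right _ _).trans (le_max_right _ _))
      ((le_max_right _ _).trans (le_max_right _ _)))

/-- LAW: monotonicity of the perspective world in the middle slot (hence, by symmetry, in every slot);
uses monotonicity of `f` for the slot's own term and `persp_mono_weight` for the two others. -/
theorem perspectiveWorld_mono (hmono : MonotoneOn f (Ici 0))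
    (hlip : ∀ x y : ℝ, 0 ≤ x → x ≤ y → f y - f x ≤ y - x) (hlow : ∀ x : ℝ, 0 ≤ x → max 2 (x + 1) ≤ f x)
    {a b b' c : ℝ} (ha : 0 < a) (hb : 0 < b) (hbb : b ≤ b') (hc : 0 < c) : W a b c ≤ W a b' c := by
  rw [hW, hW]
  have hac : 0 < a + c := by linarith
  have hb' : 0 < b' := lt_of_lt_of_le hb hbb
  have t1 : (a + c) / 2 * f (2 * b / (a + c)) ≤ (a + c) / 2 * f (2 * b' / (a + c)) := by
    apply mul_le_mul_of_nonneg_left _ (by positivity)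
    exact hmono (mem_Ici.2 (by positivity)) (mem_Ici.2 (by positivity))
      (div_le_div_of_nonneg_right (by linarith) hac.le)
  have t2 := persp_mono_weight hlip hlow (S := a + b) (S' := a + b') (b := c) (by linarith) (by linarith) hc.le
  have t3 := persp_mono_weight hlip hlow (S := b + c) (S' := b' + c) (b := a) (by linarith) (by linarith) ha.le
  exact max_le_max t1 (max_le_max t2 t3)

/-- LAW: sandwich `max(a+c, a+b, b+c) ≤ W ≤ a+b+c` on the open positive cone
(`f ≥ 2` gives the information bound, `f(x) ≤ x+2` the trivial bound). -/
theorem perspectiveWorld_sandwich (hlow : ∀ x : ℝ, 0 ≤ x → max 2 (x + 1) ≤ f x)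
    (hup : ∀ x : ℝ, 0 ≤ x → f x ≤ x + 2) {a b c : ℝ} (ha : 0 < a) (hb : 0 < b) (hc : 0 < c) :
    max (a + c) (max (a + b) (b + c)) ≤ W a b c ∧ W a b c ≤ a + b + c := by
  rw [hW]
  have low : ∀ {S t : ℝ}, 0 < S → 0 ≤ t → S ≤ S / 2 * f (2 * t / S) := by
    intro S t hS ht
    have h2 : 2 ≤ f (2 * t / S) := (le_max_left _ _).trans (hlow _ (by positivity))
    nlinarith
  have up : ∀ {S t : ℝ}, 0 < S → 0 ≤ t → S / 2 * f (2 * t / S) ≤ t + S := by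
    intro S t hS ht
    have h2 : f (2 * t / S) ≤ 2 * t / S + 2 := hup _ (by positivity)
    have h3 : S / 2 * f (2 * t / S) ≤ S / 2 * (2 * t / S + 2) := mul_le_mul_of_nonneg_left h2 (by positivity)
    have e : S / 2 * (2 * t / S + 2) = t + S := by field_simp
    linarith
  refine ⟨max_le_max (low (by linarith) hb.le) (max_le_max (low (by linarith) hc.le) (low (by linarith) ha.le)),
    max_le ?_ (max_le ?_ ?_)⟩
  · linarith [up (show 0 < a + c by linarith) hb.le]
  · linarith [up (show 0 < a + b by linarith) hc.le]
  · linarith [up (show 0 < b + c by linarith) ha.le]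

/-- ★ THE PENCIL of the perspective world is `max(f(x), ((1+x)/2)·f(2/(1+x)))`; hence
`W_f(1,x,1) = f(x)` for all `x > 0` IF AND ONLY IF `f` satisfies the FOLD for all `x > 0`. -/
theorem perspectiveWorld_pencil_iff_fold :
    (∀ x : ℝ, 0 < x → W 1 x 1 = f x) ↔ ∀ y : ℝ, 0 < y → (1 + y) * f (2 / (1 + y)) ≤ 2 * f y := by
  have pen : ∀ x : ℝ, 0 < x → W 1 x 1 = max (f x) ((1 + x) / 2 * f (2 / (1 + x))) := by
    intro x hx
    rw [hW, show ((1 : ℝ) + 1) / 2 * f (2 * x / (1 + 1)) = f x by norm_num,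
      show (2 : ℝ) * 1 = 2 by norm_num, show x + 1 = 1 + x by ring, max_self]
  constructor
  · intro h y hy
    have e := pen y hy
    rw [h y hy] at e
    have : (1 + y) / 2 * f (2 / (1 + y)) ≤ f y := by rw [e]; exact le_max_right _ _
    linarith
  · intro h x hx
    rw [pen x hx, max_eq_left]
    have := h x hx
    linarith

/-- ★ PENCIL REALISABILITY (sufficiency, assembled): an admissible profile with the FOLD is the pencil of a
functional with ALL the laws — symmetric, homogeneous, subadditive, monotone, sandwiched on the open positive
cone.  (Necessity of the fold: `fold_of_laws`.) -/
theorem perspectiveWorld_realises (hconv : ConvexOn ℝ (Ici 0) f) (hmono : MonotoneOn f (Ici 0))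
    (hlip : ∀ x y : ℝ, 0 ≤ x → x ≤ y → f y - f x ≤ y - x) (hlow : ∀ x : ℝ, 0 ≤ x → max 2 (x + 1) ≤ f x)
    (hup : ∀ x : ℝ, 0 ≤ x → f x ≤ x + 2) (hfold : ∀ y : ℝ, 0 < y → (1 + y) * f (2 / (1 + y)) ≤ 2 * f y) :
    (∀ a b c : ℝ, W a b c = W b a c ∧ W a b c = W a c b) ∧
    (∀ ν : ℝ, 0 < ν → ∀ a b c : ℝ, 0 < a → 0 < b → 0 < c → W (ν * a) (ν * b) (ν * c) = ν * W a b c) ∧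
    (∀ a b c a' b' c' : ℝ, 0 < a → 0 < b → 0 < c → 0 < a' → 0 < b' → 0 < c' →
      W (a + a') (b + b') (c + c') ≤ W a b c + W a' b' c') ∧
    (∀ a b b' c : ℝ, 0 < a → 0 < b → b ≤ b' → 0 < c → W a b c ≤ W a b' c) ∧
    (∀ a b c : ℝ, 0 < a → 0 < b → 0 < c → max (a + c) (max (a + b) (b + c)) ≤ W a b c ∧ W a b c ≤ a + b + c) ∧
    (∀ x : ℝ, 0 < x → W 1 x 1 = f x) :=
  ⟨perspectiveWorld_symm hW, fun _ hν a b c _ _ _ => perspectiveWorld_hom hW hν a b c,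
    fun _ _ _ _ _ _ ha hb hc ha' hb' hc' => perspectiveWorld_subadd hW hconv ha hb hc ha' hb' hc',
    fun _ _ _ _ ha hb hbb hc => perspectiveWorld_mono hW hmono hlip hlow ha hb hbb hc,
    fun _ _ _ ha hb hc => perspectiveWorld_sandwich hW hlow hup ha hb hc,
    (perspectiveWorld_pencil_iff_fold hW).2 hfold⟩

end Sufficiency

/-! ## §3 The perspective world is the LEAST lawful functional with a given pencil -/

section Least

variable {f : ℝ → ℝ} {W V : ℝ → ℝ → ℝ → ℝ}
  (hW : ∀ a b c : ℝ, W a b c = max ((a + c) / 2 * f (2 * b / (a + c)))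
    (max ((a + b) / 2 * f (2 * c / (a + b))) ((b + c) / 2 * f (2 * a / (b + c)))))
  (hsymm : ∀ a b c : ℝ, V a b c = V b a c ∧ V a b c = V a c b)
  (hhom : ∀ ν : ℝ, 0 < ν → ∀ a b c : ℝ, 0 < a → 0 < b → 0 < c →
    V (ν * a) (ν * b) (ν * c) = ν * V a b c)
  (hsub : ∀ a b c a' b' c' : ℝ, 0 < a → 0 < b → 0 < c → 0 < a' → 0 < b' → 0 < c' →
    V (a + a') (b + b') (c + c') ≤ V a b c + V a' b' c')
  (hpen : ∀ x : ℝ, 0 < x → V 1 x 1 = f x)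
include hW hsymm hhom hsub hpen

/-- ★ LEAST EXTENSION: every symmetric, homogeneous, subadditive `V` with pencil `f` dominates the perspective
world `W_f` on the open positive cone (balancing two slots never increases a lawful functional:
`V(a,b,c) = (V(a,b,c)+V(c,b,a))/2 ≥ V((a+c)/2, b, (a+c)/2) = ((a+c)/2)·f(2b/(a+c))`).  With §2: `W_f` is the
MINIMUM of the fibre of lawful functionals over an admissible pencil, so «is `f` compatible with the upper bounds
`V(shapeᵢ) ≤ uᵢ` we hold?» is the finite test `W_f(shapeᵢ) ≤ uᵢ`. -/
theorem perspectiveWorld_le_of_laws {a b c : ℝ} (ha : 0 < a) (hb : 0 < b) (hc : 0 < c) :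
    W a b c ≤ V a b c := by
  rw [hW]
  have hac : 0 < a + c := by linarith
  have hab : 0 < a + b := by linarith
  have hbc : 0 < b + c := by linarith
  -- slot b
  have s13 : V c b a = V a b c := by
    rw [(hsymm c b a).2, (hsymm c a b).1, ← (hsymm a b c).2]
  have t1 : (a + c) / 2 * f (2 * b / (a + c)) ≤ V a b c := by
    have h := hsub a b c c b a ha hb hc hc hb ha
    have e := hhom (a + c) hac 1 (2 * b / (a + c)) 1 one_pos (by positivity) one_pos
    rw [mul_one, show (a + c) * (2 * b / (a + c)) = b + b by field_simp; ring,
      hpen _ (by positivity)] at e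
    rw [show c + a = a + c by ring, e, s13] at h
    linarith
  -- slot c
  have t2 : (a + b) / 2 * f (2 * c / (a + b)) ≤ V a b c := by
    have h := hsub a b c b a c ha hb hc hb ha hc
    have e := hhom (a + b) hab 1 1 (2 * c / (a + b)) one_pos one_pos (by positivity)
    rw [mul_one, show (a + b) * (2 * c / (a + b)) = c + c by field_simp; ring,
      (hsymm 1 1 (2 * c / (a + b))).2, hpen _ (by positivity)] at e
    rw [show b + a = a + b by ring, e, ← (hsymm a b c).1] at h
    linarith
  -- slot a
  have t3 : (b + c) / 2 * f (2 * a / (b + c)) ≤ V a b c := by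
    have h := hsub a b c a c b ha hb hc ha hc hb
    have e := hhom (b + c) hbc (2 * a / (b + c)) 1 1 (by positivity) one_pos one_pos
    rw [mul_one, show (b + c) * (2 * a / (b + c)) = a + a by field_simp; ring,
      (hsymm (2 * a / (b + c)) 1 1).1, hpen _ (by positivity)] at e
    rw [show c + b = b + c by ring, e, ← (hsymm a b c).2] at h
    linarith
  exact max_le t1 (max_le t2 t3)

end Least

/-! ## §4 The true pencil is admissible; its perspective world is a lawful minorant of `ω` -/

/-- The pencil `x ↦ ω(1,x,1)` satisfies all six hypotheses of §2: convex (Lotti–Romani), monotone, `1`-Lipschitz,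
`max(2,x+1) ≤ ω(1,x,1) ≤ x+2`, and the FOLD (here re-derived from the three laws via `fold_of_laws`). -/
theorem omega_pencil_admissible :
    ConvexOn ℝ (Ici 0) (fun x : ℝ => omegaRect ℂ 1 x 1) ∧
    MonotoneOn (fun x : ℝ => omegaRect ℂ 1 x 1) (Ici 0) ∧
    (∀ x y : ℝ, 0 ≤ x → x ≤ y → omegaRect ℂ 1 y 1 - omegaRect ℂ 1 x 1 ≤ y - x) ∧
    (∀ x : ℝ, 0 ≤ x → max 2 (x + 1) ≤ omegaRect ℂ 1 x 1) ∧
    (∀ x : ℝ, 0 ≤ x → omegaRect ℂ 1 x 1 ≤ x + 2) ∧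
    (∀ y : ℝ, 0 < y → (1 + y) * omegaRect ℂ 1 (2 / (1 + y)) 1 ≤ 2 * omegaRect ℂ 1 y 1) := by
  refine ⟨omegaRect_convexOn_one_mid_one ℂ, fun x _ y _ hxy => omegaRect_one_mid_one_mono ℂ hxy,
    fun x y _ hxy => by linarith [omegaRect_one_mid_one_le_add ℂ hxy],
    fun x _ => max_le (two_le_omegaRect_one_mid_one ℂ x) (add_one_le_omegaRect_one_mid_one ℂ x),
    fun x hx => ?_, fun y hy => fold_of_laws omegaRect_laws.1 omegaRect_laws.2.1 omegaRect_laws.2.2 hy⟩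
  have h := omegaRect_one_mid_one_le_add ℂ hx
  rw [omegaRect_one_zero_one] at h
  linarith

/-- ★ MINIMAL MODEL of the true pencil: the perspective world `W_ω` of `x ↦ ω(1,x,1)` is a lawful functional
(symmetric, homogeneous, subadditive, monotone, sandwiched) with EXACTLY the true pencil, and it is a MINORANT
of `ω` on the open positive cone: `max(a+b,b+c,c+a) ≤ W_ω(a,b,c) ≤ ω(a,b,c)`.  (So the pencil alone can never
be refuted by 3D-lawfulness; only inputs beyond the laws — upper bounds at non-pencil shapes tested on `W_ω`,
exact-tight faces, spectrum structure — constrain it further.) -/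
theorem omega_perspective_minorant {W : ℝ → ℝ → ℝ → ℝ}
    (hW : ∀ a b c : ℝ, W a b c = max ((a + c) / 2 * omegaRect ℂ 1 (2 * b / (a + c)) 1)
      (max ((a + b) / 2 * omegaRect ℂ 1 (2 * c / (a + b)) 1) ((b + c) / 2 * omegaRect ℂ 1 (2 * a / (b + c)) 1))) :
    (∀ x : ℝ, 0 < x → W 1 x 1 = omegaRect ℂ 1 x 1) ∧
    (∀ a b c a' b' c' : ℝ, 0 < a → 0 < b → 0 < c → 0 < a' → 0 < b' → 0 < c' →
      W (a + a') (b + b') (c + c') ≤ W a b c + W a' b' c') ∧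
    (∀ a b c : ℝ, 0 < a → 0 < b → 0 < c →
      max (a + c) (max (a + b) (b + c)) ≤ W a b c ∧ W a b c ≤ omegaRect ℂ a b c) := by
  obtain ⟨hconv, hmono, hlip, hlow, hup, hfold⟩ := omega_pencil_admissible
  have R := perspectiveWorld_realises (f := fun x : ℝ => omegaRect ℂ 1 x 1) hW hconv hmono hlip hlow hup hfold
  refine ⟨R.2.2.2.2.2, R.2.2.1, fun a b c ha hb hc => ⟨(R.2.2.2.2.1 a b c ha hb hc).1, ?_⟩⟩
  exact perspectiveWorld_le_of_laws (f := fun x : ℝ => omegaRect ℂ 1 x 1) hW omegaRect_laws.1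
    omegaRect_laws.2.1 omegaRect_laws.2.2 (fun x _ => rfl) ha hb hc


end Summit.MatrixMultiplication.MatrixMultiplication.Theorems.FarEdgeDescentPencilRealisability
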